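import Summits.ABC.IUTFork.Repair.CandMochizuki32Split
import Summits.ABC.IUTFork.Repair.CandMochizuki1
import Summits.ABC.IUTFork.Repair.CandMochizuki2
import Summits.ABC.IUTFork.Repair.CandMochizuki3
import Summits.ABC.IUTFork.Repair.CandMochizuki4
import Summits.ABC.IUTFork.Repair.CandMochizuki5
import Summits.ABC.IUTFork.Repair.CandMochizuki6
import Summits.ABC.IUTFork.Repair.CandMochizuki7
import Summits.ABC.IUTFork.Repair.CandMochizuki40
import Summits.ABC.IUTFork.Repair.CandMochizuki41
import HarnessLib

/-!
# REPAIR branch B1 / CandMochizuki32SplitB1 — the P♮₁ COLUMN, part II: the cells of the SIBLING rows of sub-cell B1 at abc-iut-w5-d230's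
# SPLIT natural bed — RP-M03a/b, M04a/b/c, M36a/b/c/d (rp-m2) · RP-M01a/b/c, M02a/b, M45, M47a/b/c (rp-m1) · RP-M40a/b (rp-m4)

PROOF-ONLY file (no definition, no `Prop` fact; class `Mochizuki`, sub-cell B1, seat abc-iut-rp-m3 gen 3 for the whole B1 column per
abc-iut-rp-plan FOLD #1 (gen 2) 09:49:51Z (D5); sequel of `CandMochizuki32Split` = the exact hull of P♮₁ + rp-m3's own rows). TAKES NO SIDE
between Mochizuki, Scholze–Stix, Joshi, Dupuy–Hilado or anyone; nothing here asserts abc or [IUTchIII] Cor. 3.12 proved or refuted;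
candidates are hypotheses — typed ≠ proved, instantiated ≠ endorsed. Closed theorems about TOY MODEL DATA, BY NAME on the bed
`Cor312PilotKummerSplit{Shells,Model,Thm311,Witness}` (w5-d230, p431201 ff.) and on the sibling seats' LANDED candidate files
`Repair.CandMochizuki2/4/6` (rp-m2: p427310, p427897, p428116), `Repair.CandMochizuki1/3/5/7` (rp-m1: p428329, p428476, p429432, p437224),
`Repair.CandMochizuki40` (rp-m4: p431550) — the pattern of rp-m2's `CandMochizuki4Profile` (P♮/U) and rp-m1's `CandMochizuki1Beds`, none
restated; DEFS-FREEZE kept. The bed: two valuations over one place, split packets `(ℚ²)^{⊗(j+1)}`, TRIVIAL Ism, `qDatumSplit := swapFamily·{Θ-point}`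
with `swapFamily ∈ (Ind1)` the capsule swap `(0 j)`; pins ✓, typed Thm 3.11 ✓, S ✓ NON-identified, Statement STRICT, hull = `box {c₀}` of
log-volume `−2` vs `−1 − 2^j` for both pilot boxes (part I `split_hull_logvol` / `split_inflation`).

CELLS (EVAL-LOG column «P♮₁»; ✓ HOLDS / ✗ FAILS; bed (`splitFull`, `splitSetting`, `boxRegion`, `qDatumSplit`)):
| row | decl | P♮₁ | by |
|---|---|---|---|
| RP-M03a | `CandMochizuki2.H` (∃ Out) | ✓ `M03a_split` | constant assignment |
| RP-M03b | `CandMochizuki2.H'` (∃ Out) | ✓ `M03b_split` | R3 through `ρ` (`exists_H'_iff`) |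
| RP-M04a / b / c | `CandMochizuki4.H` / `H'` / `H''` | ✓ ✓ ✓ | `H_iff_S_of_pinned3` / `ρ qK ⊆ hull` / typed (IPL) ∧ (SHE) of `splitFull` |
| RP-M36a / b (sat = id) / c / d | `CandMochizuki6.H` / `H'` / `H''` / `H'''` | ✓ ✓ ✓ ✓ | extensivity / q-box a possible image / `−1−2^j ≤ −2` / `H''' ⟺ Statement` |
| RP-M01a | `CandMochizuki1.H` | ✗ `not_M01a_split` | the Θ-pilot's OWN volume EQUALS `−|log q|` (`split_thetaPilotOwnVol`), so the strict left clause fails |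
| RP-M01b | `CandMochizuki1.H'` (ΘInd) | ✗ `not_M01b_split` | (ΘInd) as typed denies every ⟨Ind⟩-transport of a Θ-image onto the q-datum; here `qK = swapFamily·frobΨ 0`, `swapFamily ∈ (Ind1)` |
| RP-M01c | `CandMochizuki1.H''` | ✗ `not_M01c_split` | `own = −|log q| ≠ (5/2)·(−|log q|)` |
| RP-M02a / b | `CandMochizuki3.H` / `H'` | ✓ ✓ | (ii)(a) ∧ admissible / NOT a «single hol. str.» (the `N = 1` class of RP-M31 fails, part I `not_M31_split`) |
| RP-M45 | `CandMochizuki5.H` | ✓ `M45_split` | finite `−|log Θ|` STRICTLY above `own = −|log q|` |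
| RP-M47a / b | `CandMochizuki7.H` / `H'` | ✗ ✗ | the split signature IS rigidified: `−1` is an isometry of the log-shell but `Ism = {1}` (`not_M47a_split`); `IsmIsometric` ✓ |
| RP-M47c | `CandMochizuki7.H''` (`FullInd`) | ✗ `not_M47c_split` | `swapFamily` maps every integral structure `box ∅` onto itself and is no (Ind2)-family (those act trivially, `apply_eq_self_of_mem_Ind2Family`) |
| RP-M40a / b | `CandMochizuki40.H` / `H'` | ✗ ✗ | one place: `Placewise ⟺ Statement` (rp-m4's index-generic one-place lemmas); `Placewise` ✓ |
Package `profile_split`. READING (neutral): on the bed realising S by print's (Ind1) mechanism every REGION/HULL/VOLUME-reading row of B1 holds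
(as at P♮ — no m2 row is STRONGER than S), every own-volume-STRICT / NO-TRANSPORT / un-rigidification row fails: (ΘInd) (M01b) denies precisely an
automorphism «appearing in (Ind1,2)» carrying a Θ-image to the q-datum, which is what realises S here; (VUC3)/(†ΘCR)-type un-rigidification (M47)
is FALSE on this S-bed (its Ism is smaller than the CM's), so un-rigidifying the unit group is not what supplies S at P♮₁ — the (Ind1) capsule
permutation is. No verdict word moves; the column records which rows SEE the (Ind1) mechanism. [claim: Mochizuki2012, status: disputed] for every
IUT noun; [cite: ScholzeStix2018, §2.2 pp. 9–10] for the countermodel side; [cite: DupuyHilado2020, §4.7] for the (Ind1) reading.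

v2 (APPEND, gen 3, 2026-08-26T11:40Z): §5 — the P♮₁ cell of the NEW row RP-M51 (rp-m4's `CandMochizuki41`, (C14)/(Lin)-denial = (MlLV) non-linearity,
p440036): **`H` (= ¬Lin) HOLDS at P♮₁** (`M51_H_split`): the hull volume is `−2` at both labels while the Θ-pilot's own volumes are `−3`, `−5`
(part I `split_thetaLocal`, `split_honesty_vector`), so no single scalar `r` relates them (`2/3 ≠ 2/5`) — the FIRST bed of record on which
NON-LINEARITY and S hold TOGETHER (on every (Ind)-trivial bed `H ⇒ ¬S`, rp-m4's `H_refutes_residual_of_indTrivial`; at P♮ (Lin) holds with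
`r = 1/2`, `lin_natSetting`; at FLIP `H` holds with `¬S`): the (Ind1) capsule-permutation orbit inflates by `2^j − 1`, NOT proportionally to the
own volume `1 + 2^j`. Package `M51_split_profile`. No side taken.
-/

noncomputable section

open Set

namespace Summit.ABC.IUTFork.Repair.CandMochizuki32SplitB1

open Thm311 Cor312 Cor312Vol Cor312.Checks Cor312.IdentifiedNonVacuity Cor312Vol.NaiveWitness Cor312Vol.PinnedWitness
  Cor312Vol.SplitWitness Repair.CandMochizuki32 Repair.CandMochizuki32Split Literature.IUT.LogThetaLattice

/-! ## 1. rp-m2's rows (abc-iut-rp-m2's `CandMochizuki2/4/6`): RP-M03a/b, RP-M04a/b/c, RP-M36a/b/c/d -/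

/-- (IPL) as typed holds for the split full situation (link data `naiveLink`, one-object groupoid; as `CandMochizuki4Profile.natFull_ipl`). [folklore] -/
theorem splitFull_ipl : splitFull.link.IPL :=
  splitFull.link.ipl_iff_nonempty.2 fun n m => ⟨splitFull.link.kumDelta n m ≪≫ (splitFull.link.kumDelta (n + 1) m).symm⟩

/-- The hull-level residual `GapH3` HOLDS at P♮₁. [folklore] -/
theorem gapH3_split : GapH3 splitFull.toLatticeSituation splitSetting boxRegion qDatumSplit := fun _ =>
  licence_of_pilotKummerCompatHull _ _ _ _ splitSetting_qPinned splitSetting_pilotKummerCompatHull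

/-- **RP-M03a at P♮₁: HOLDS** (the constant assignment, `CandMochizuki2.H_const`). [folklore] -/
theorem M03a_split : ∃ Out : CandMochizuki2.OutputAssignment splitFull.toLatticeSituation splitSetting,
    CandMochizuki2.H splitFull.toLatticeSituation splitSetting Out :=
  ⟨_, CandMochizuki2.H_const _ _⟩

/-- **RP-M03b at P♮₁: HOLDS** (Reading R3 through `ρ`, `CandMochizuki2.exists_H'_iff`). [folklore] -/
theorem M03b_split : ∃ Out : CandMochizuki2.OutputAssignment splitFull.toLatticeSituation splitSetting,
    CandMochizuki2.H' splitFull.toLatticeSituation splitSetting boxRegion qDatumSplit Out :=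
  (CandMochizuki2.exists_H'_iff _ _ _ _).2 fun _ j vQ => by
    rw [← splitSetting_qPinned j vQ]
    exact split_reading3 j vQ

/-- **RP-M04a at P♮₁: HOLDS** (`CandMochizuki4.H_iff_S_of_pinned3`). [folklore] -/
theorem M04a_split : CandMochizuki4.H splitFull.toLatticeSituation splitSetting boxRegion qDatumSplit :=
  (CandMochizuki4.H_iff_S_of_pinned3 _ _ _ _ split_honesty_vector.1 splitSetting_pinnedRegions3).2 splitSetting_pilotKummerIndRelated

/-- **RP-M04b at P♮₁: HOLDS** (`ρ qK ⊆ hull`, w5-d230's `splitSetting_pilotKummerCompatHull`). [folklore] -/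
theorem M04b_split : CandMochizuki4.H' splitFull.toLatticeSituation splitSetting boxRegion qDatumSplit :=
  fun _ _ vQ => splitSetting_pilotKummerCompatHull _ vQ

/-- **RP-M04c at P♮₁: HOLDS** (typed (IPL) ∧ (SHE) from the typed Thm 3.11 of `splitFull`). [folklore] -/
theorem M04c_split : CandMochizuki4.H'' splitFull :=
  ⟨splitFull_ipl, splitFull.sheTyped_of_statement_of_ipl splitFull_statement splitFull_ipl⟩

/-- **RP-M36a at P♮₁ (sat = id): HOLDS** (extensivity + monotonicity of the hull). [folklore] -/
theorem M36a_split : CandMochizuki6.H splitFull.toLatticeSituation splitSetting (fun _ _ U => U) :=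
  ⟨fun _ _ _ => subset_rfl, fun _ vQ _ hU => (Set.subset_sUnion_of_mem hU).trans ((splitSetting.frame _ vQ).subset_hull _)⟩

/-- **RP-M36b at P♮₁ with the honest saturation `id`: HOLDS** — the q-box IS a possible image. [folklore] -/
theorem M36b_split : CandMochizuki6.H' splitFull.toLatticeSituation splitSetting boxRegion qDatumSplit (fun _ _ U => U) :=
  ⟨M36a_split, fun i vQ =>
    ⟨boxRegion qDatumSplit _ vQ, (splitSetting_qPinned _ vQ) ▸ split_reading3 (Setting.labelSucc i) vQ, subset_rfl⟩⟩

/-- **RP-M36c (READING 0) at P♮₁: HOLDS** — per packet `qLocal = −1 − 2^j ≤ −2 = thetaLocal` (strictly). [folklore] -/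
theorem M36c_split : CandMochizuki6.H'' splitFull.toLatticeSituation splitSetting := fun i vQ =>
  (splitSetting_qLocal_lt_thetaLocal i vQ).1.le

/-- **RP-M36d at P♮₁: HOLDS** (`H''' ⟺ Statement` under `ThetaFinite`). [folklore] -/
theorem M36d_split : CandMochizuki6.H''' splitFull.toLatticeSituation splitSetting :=
  (CandMochizuki6.H'''_iff_statement _ _ splitSetting_thetaFinite).2 splitSetting_statement_strict.1

/-! ## 2. rp-m1's rows (abc-iut-rp-m1's `CandMochizuki1/3/5/7`): RP-M01a/b/c, RP-M02a/b, RP-M45, RP-M47a/b/c -/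

/-- **The Θ-pilot's OWN procession-normalised volume equals `−|log(q)|` at P♮₁** (`= −4`): every Kummer image is the Θ-box, whose volume
is the q-box's. [folklore] -/
theorem split_thetaPilotOwnVol (m : ℤ) :
    CandMochizuki1.thetaPilotOwnVol splitFull.toLatticeSituation splitSetting m = splitSetting.negLogQ := by
  unfold CandMochizuki1.thetaPilotOwnVol Setting.negLogQ
  congr 1
  funext i
  congr 1
  funext vQ
  rw [splitSetting_thetaRegion, ← splitSetting_thetaRegion3]
  exact split_honesty_vector.2.2.2.2.2.2 i vQ

/-- **RP-M01a at P♮₁: FAILS** — its strict left clause `own < −|log(q)|` fails (`own = −|log(q)|`), although its right conjunct (the Statement)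
holds strictly. [folklore] -/
theorem not_M01a_split : ¬ CandMochizuki1.H splitFull.toLatticeSituation splitSetting boxRegion qDatumSplit := fun h => by
  have h0 := h.1 0
  rw [split_thetaPilotOwnVol] at h0
  exact lt_irrefl _ h0

/-- **RP-M01b at P♮₁: FAILS** — (ΘInd) as typed denies every ⟨(Ind1)∪(Ind2)⟩-transport of a Θ-Kummer image onto the q-datum, and at P♮₁
`qK = swapFamily·frobΨ 0` with `swapFamily ∈ (Ind1)` (`splitSetting_pilotKummerCompat`). [folklore] -/
theorem not_M01b_split : ¬ CandMochizuki1.H' splitFull.toLatticeSituation splitSetting boxRegion qDatumSplit := fun h =>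
  (CandMochizuki1.H'_iff_not_pilotKummerCompat _ _ _ _).1 h splitSetting_pilotKummerCompat

/-- **RP-M01c at P♮₁: FAILS** — `own = −|log(q)| ≠ avgJsq·(−|log(q)|)` since `avgJsq − 1 ≥ 3/2` and `−|log(q)| < 0`. [folklore] -/
theorem not_M01c_split : ¬ CandMochizuki1.H'' splitFull.toLatticeSituation splitSetting boxRegion qDatumSplit := fun h => by
  have h0 := h 0
  rw [split_thetaPilotOwnVol] at h0
  have hq : splitSetting.negLogQ < 0 := splitSetting_absLogQPos
  have ha := CandMochizuki1.three_halves_le_avgJsq_sub_one splitIndex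
  nlinarith

/-- **RP-M02a at P♮₁: HOLDS** (admissible Θ-images ∧ Thm 3.11 (ii)(a)). [folklore] -/
theorem M02a_split : CandMochizuki3.H splitFull.toLatticeSituation splitSetting boxRegion qDatumSplit :=
  (CandMochizuki3.H_iff _ _ _ _).2 ⟨splitSetting_thetaRegionsAdm, (split_partII splitSetting.n).1⟩

/-- **RP-M02b at P♮₁: HOLDS** — P♮₁ is NOT a «single hol. str.» in rp-m1's typed sense: under the q-pin `SingleHolStr` is the `N = 1` scaling
class of RP-M31, which fails here (`not_M31_split 1`). [folklore] -/
theorem M02b_split : CandMochizuki3.H' splitFull.toLatticeSituation splitSetting boxRegion qDatumSplit := fun h =>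
  not_M31_split 1 ((CandMochizuki31.H_one_iff _ _ _ _).2
    ((CandMochizuki3.singleHolStr_iff_scaled _ _ _ _ splitSetting_qPinned).1 h))

/-- **RP-M45 at P♮₁: HOLDS** — `−|log(Θ)|` is finite and STRICTLY exceeds the Θ-pilot's own volume `= −|log(q)|` (strict Statement). [folklore] -/
theorem M45_split : CandMochizuki5.H splitFull.toLatticeSituation splitSetting boxRegion qDatumSplit :=
  ⟨splitSetting_statement_strict.1.1, fun m => by rw [split_thetaPilotOwnVol]; exact splitSetting_statement_strict.2⟩

/-- The sign `−1` maps the unit-ball log-shell of the split signature onto itself. [folklore] -/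
theorem neg_image_shell : (LinearEquiv.neg ℚ : ℚ ≃ₗ[ℚ] ℚ) '' {x : ℚ | |x| ≤ 1} = {x : ℚ | |x| ≤ 1} := by
  ext x
  simp only [Set.mem_image, Set.mem_setOf_eq, LinearEquiv.neg_apply]
  constructor
  · rintro ⟨y, hy, rfl⟩; rwa [abs_neg]
  · intro hx; exact ⟨-x, by rwa [abs_neg], neg_neg x⟩

/-- **RP-M47a at P♮₁: `FullIsm` FAILS** — the split signature IS rigidified: `−1` is an isometry of the log-shell but `Ism = {1}`. S is supplied
on this bed by (Ind1) alone. [folklore] -/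
theorem not_M47a_split : ¬ CandMochizuki7.H splitFull.toLatticeSituation splitSetting boxRegion qDatumSplit := by
  intro h
  have h1 := (h true (LinearEquiv.neg ℚ) neg_image_shell).1
  have h2 : (LinearEquiv.neg ℚ : ℚ ≃ₗ[ℚ] ℚ) = LinearEquiv.refl ℚ ℚ := h1
  have h3 := LinearEquiv.congr_fun h2 1
  norm_num at h3

/-- **RP-M47b at P♮₁: FAILS** (its first conjunct is M47a). [folklore] -/
theorem not_M47b_split : ¬ CandMochizuki7.H' splitFull.toLatticeSituation splitSetting boxRegion qDatumSplit := fun h =>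
  not_M47a_split h.1

/-- … while print's converse `IsmIsometric` HOLDS trivially (Ism = stripAut = {1}). [folklore] -/
theorem ismIsometric_split : CandMochizuki7.IsmIsometric splitShells := by
  intro v g hg
  have h1 : g = LinearEquiv.refl ℚ ℚ := by rcases hg with h | h <;> exact h
  subst h1
  ext x
  simp

/-- An (Ind2)-family of the split shells acts as the IDENTITY on every packet (Ism is trivial). [folklore] -/
theorem apply_eq_self_of_mem_Ind2Family {Φ : splitShells.PacketAut} (h : Φ ∈ splitShells.Ind2Family) (j : splitIndex.Label)
    (vQ : splitIndex.VQ) (x : splitShells.Packet j vQ) : Φ j vQ x = x := by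
  obtain ⟨g, hg, hΦ⟩ := h j vQ
  rw [hΦ]
  have hs : (fun i => splitShells.summandwise vQ (g i)) = fun _ => LinearEquiv.refl ℚ (splitShells.Packet1 vQ) :=
    funext fun i => summandwise_refl' vQ _ fun v => hg i v
  rw [hs, splitShells.factorwise_refl]
  rfl

/-- **RP-M47c at P♮₁: `FullInd` FAILS** — the capsule swap maps every integral structure `box ∅` onto itself but is no (Ind2)-family (those act
trivially; the swap moves the Θ-point). [folklore] -/
theorem not_M47c_split : ¬ CandMochizuki7.H'' splitFull.toLatticeSituation splitSetting boxRegion qDatumSplit := by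
  intro h
  have hj := Setting.labelSucc_ne_zero (⟨0, by decide⟩ : Fin splitIndex.lstar)
  have hpk : ∀ (j : splitIndex.Label) (vQ : splitIndex.VQ),
      swapFamily j vQ '' (splitFull.toLatticeSituation.D splitSetting.n).shellPk j vQ =
        (splitFull.toLatticeSituation.D splitSetting.n).shellPk j vQ := fun j vQ => by
    show swapFamily j vQ '' box ∅ = box ∅
    rw [image_box_of_perm (swapFamily_mem_indGroup.2 j vQ)]
    unfold permD; rw [Finset.image_empty]
  exact swapFamily_thetaPt_ne hj () (apply_eq_self_of_mem_Ind2Family (h swapFamily hpk) _ () _)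

/-! ## 3. rp-m4's rows (abc-iut-rp-m4's `CandMochizuki40`): one place -/

/-- **`Placewise` HOLDS at P♮₁** (one place: placewise = global, m4's index-generic `placewise_iff_statement_onePlace`). [folklore] -/
theorem placewise_split : CandMochizuki40.Placewise splitSetting :=
  (CandMochizuki40.placewise_iff_statement_onePlace splitSetting).2 splitSetting_statement_strict.1

/-- **RP-M40a at P♮₁: FAILS** (`H ⟺ ¬Statement` at one place). [folklore] -/
theorem not_M40a_split : ¬ CandMochizuki40.H splitSetting := fun h =>
  (CandMochizuki40.H_iff_not_statement_onePlace splitSetting).1 h splitSetting_statement_strict.1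

/-- **RP-M40b at P♮₁: FAILS** (one-place collapse, `CandMochizuki40.not_H'_onePlace`). [folklore] -/
theorem not_M40b_split : ¬ CandMochizuki40.H' splitSetting := CandMochizuki40.not_H'_onePlace splitSetting

/-! ## 4. The package -/

/-- **THE P♮₁ COLUMN OF SUB-CELL B1, packaged** (the bed's own interface ∧ pins ∧ S ∧ C ∧ strict Statement ∧ ¬IdentifiedReading are
w5-d230's `pilotKummerIndRelated_satisfiable_by_capsule_permutation`): m3 `H`/`H'`/`H''` ✓, `AO4` ✗, cap-0 ✗, exact cap ✓, `H_N` ✗ (N = 1, 2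
listed; `not_M31_split` for all N); m2 all ✓ (M36a/b with sat = id) ∧ GapH3; m1 M01a/b/c ✗, M02a/b ✓, M45 ✓, M47a/b/c ✗ with `IsmIsometric` ✓;
m4 Placewise ✓, M40a/b ✗. [claim: Mochizuki2012, status: disputed] -/
theorem profile_split :
    (PilotKummerIndRelated splitFull.toLatticeSituation splitSetting boxRegion qDatumSplit ∧ ¬ splitSetting.IdentifiedReading) ∧
    (H splitFull.toLatticeSituation splitSetting boxRegion qDatumSplit ∧ H' splitFull.toLatticeSituation splitSetting boxRegion qDatumSplit ∧
      H'' splitFull.toLatticeSituation splitSetting boxRegion qDatumSplit ∧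
      ¬ CandMochizuki33.AO4 splitFull.toLatticeSituation splitSetting boxRegion qDatumSplit ∧
      ¬ CandMochizuki30.H splitFull.toLatticeSituation splitSetting boxRegion qDatumSplit (fun _ _ => 0) ∧
      CandMochizuki30.H splitFull.toLatticeSituation splitSetting boxRegion qDatumSplit (fun i _ => (2 : ℝ) ^ ((i : ℕ) + 1) - 1) ∧
      ¬ CandMochizuki31.H splitFull.toLatticeSituation splitSetting boxRegion qDatumSplit 1 ∧
      ¬ CandMochizuki31.H splitFull.toLatticeSituation splitSetting boxRegion qDatumSplit 2) ∧
    ((∃ Out : CandMochizuki2.OutputAssignment splitFull.toLatticeSituation splitSetting,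
        CandMochizuki2.H splitFull.toLatticeSituation splitSetting Out) ∧
      (∃ Out : CandMochizuki2.OutputAssignment splitFull.toLatticeSituation splitSetting,
        CandMochizuki2.H' splitFull.toLatticeSituation splitSetting boxRegion qDatumSplit Out) ∧
      CandMochizuki4.H splitFull.toLatticeSituation splitSetting boxRegion qDatumSplit ∧
      CandMochizuki4.H' splitFull.toLatticeSituation splitSetting boxRegion qDatumSplit ∧ CandMochizuki4.H'' splitFull ∧
      CandMochizuki6.H splitFull.toLatticeSituation splitSetting (fun _ _ U => U) ∧
      CandMochizuki6.H' splitFull.toLatticeSituation splitSetting boxRegion qDatumSplit (fun _ _ U => U) ∧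
      CandMochizuki6.H'' splitFull.toLatticeSituation splitSetting ∧ CandMochizuki6.H''' splitFull.toLatticeSituation splitSetting ∧
      GapH3 splitFull.toLatticeSituation splitSetting boxRegion qDatumSplit) ∧
    (¬ CandMochizuki1.H splitFull.toLatticeSituation splitSetting boxRegion qDatumSplit ∧
      ¬ CandMochizuki1.H' splitFull.toLatticeSituation splitSetting boxRegion qDatumSplit ∧
      ¬ CandMochizuki1.H'' splitFull.toLatticeSituation splitSetting boxRegion qDatumSplit ∧
      CandMochizuki3.H splitFull.toLatticeSituation splitSetting boxRegion qDatumSplit ∧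
      CandMochizuki3.H' splitFull.toLatticeSituation splitSetting boxRegion qDatumSplit ∧
      CandMochizuki5.H splitFull.toLatticeSituation splitSetting boxRegion qDatumSplit ∧
      ¬ CandMochizuki7.H splitFull.toLatticeSituation splitSetting boxRegion qDatumSplit ∧
      ¬ CandMochizuki7.H' splitFull.toLatticeSituation splitSetting boxRegion qDatumSplit ∧ CandMochizuki7.IsmIsometric splitShells ∧
      ¬ CandMochizuki7.H'' splitFull.toLatticeSituation splitSetting boxRegion qDatumSplit) ∧
    (CandMochizuki40.Placewise splitSetting ∧ ¬ CandMochizuki40.H splitSetting ∧ ¬ CandMochizuki40.H' splitSetting) :=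
  ⟨⟨splitSetting_pilotKummerIndRelated, splitSetting_not_identifiedReading⟩,
    ⟨M32a_split, M32b_split, M32c_split, not_AO4_split, not_M06_zero_split, M06_split_exact, not_M31_split 1, not_M31_split 2⟩,
    ⟨M03a_split, M03b_split, M04a_split, M04b_split, M04c_split, M36a_split, M36b_split, M36c_split, M36d_split, gapH3_split⟩,
    ⟨not_M01a_split, not_M01b_split, not_M01c_split, M02a_split, M02b_split, M45_split, not_M47a_split, not_M47b_split, ismIsometric_split,
      not_M47c_split⟩,
    ⟨placewise_split, not_M40a_split, not_M40b_split⟩⟩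

/-! ## 5. (appended v2) RP-M51 (rp-m4's `CandMochizuki41`): (MlLV) NON-LINEARITY HOLDS at P♮₁, together with S -/

/-- The Θ-pilot's own packet volume at a label `j ∈ 𝔽_l^⋇` of P♮₁: `−1 − 2^j` (every Kummer image is the Θ-box). [folklore] -/
theorem split_ownVolAt (m : ℤ) (i : Fin splitIndex.lstar) (vQ : splitIndex.VQ) :
    CandMochizuki41.ownVolAt splitFull.toLatticeSituation splitSetting m (Setting.labelSucc i) vQ = -1 - (2 : ℝ) ^ ((i : ℕ) + 1) := by
  unfold CandMochizuki41.ownVolAt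
  rw [splitSetting_thetaRegion, ← splitSetting_thetaRegion3, split_honesty_vector.2.2.2.2.2.2 i vQ, splitSetting_qLocal, card_DTheta]
  push_cast
  ring

/-- **(Lin) FAILS at every place and (Ind3)-index of P♮₁**: the hull volume `−2` (part I `split_thetaLocal`) would have to be `r·(−3)` at the label
`1` and `r·(−5)` at the label `2`. [folklore] -/
theorem not_linAt_split (m : ℤ) (vQ : splitIndex.VQ) : ¬ CandMochizuki41.LinAt splitFull.toLatticeSituation splitSetting m vQ := by
  rintro ⟨r, hr⟩
  have h0 := hr ⟨0, by decide⟩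
  have h1 := hr ⟨1, by decide⟩
  rw [split_thetaLocal, split_ownVolAt, WithTop.coe_eq_coe] at h0 h1
  norm_num at h0 h1
  linarith

/-- **RP-M51 at P♮₁: `H` (= ¬(Lin), (C14)/(MlLV)) HOLDS** — and S, the three pins, the typed Thm 3.11 and the STRICT Statement hold there too
(abc-iut-w5-d230): the first bed of record where the non-linearity reading and S coexist. [claim: Mochizuki2012, status: disputed] -/
theorem M51_H_split : CandMochizuki41.H splitFull.toLatticeSituation splitSetting := fun h => not_linAt_split 0 () (h 0 ())

/-- **RP-M51 P♮₁ profile, packaged**: `H` ∧ S ∧ PinnedRegions3 ∧ Statement strict ∧ ¬IdentifiedReading at the split bed. [claim: Mochizuki2012, status: disputed] -/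
theorem M51_split_profile :
    CandMochizuki41.H splitFull.toLatticeSituation splitSetting ∧
      PilotKummerIndRelated splitFull.toLatticeSituation splitSetting boxRegion qDatumSplit ∧
      PinnedRegions3 splitFull.toLatticeSituation splitSetting boxRegion qDatumSplit ∧
      splitSetting.Statement ∧ ((splitSetting.negLogQ : ℝ) : WithTop ℝ) < splitSetting.negLogTheta ∧ ¬ splitSetting.IdentifiedReading :=
  ⟨M51_H_split, splitSetting_pilotKummerIndRelated, splitSetting_pinnedRegions3, splitSetting_statement_strict.1,
    splitSetting_statement_strict.2, splitSetting_not_identifiedReading⟩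

end Summit.ABC.IUTFork.Repair.CandMochizuki32SplitB1

end
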